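import Summits.Schanuel.Schanuel.Theorems.RootDecomp1KSiegelFunctions01

/-!
# RootDecomp1KSiegelFunctions — lens 1, generation 71, NODE 31 «THE HEIGHT BINDER HALVED: `HeightComparison ⟸ SiegelFunctionsAll`, ARITHMETIC HALF PROVED» (×0-AS-RECORD + one contingent ×1 at FLOOR G (a) — PRICE 31 L3149, RULING L3160, NODE L3172, VERDICT L3175): the node-12 hypothesis binder `HeightComparison` (Weil–Siegel height comparison on a plane curve) is, definitionally, `∀ P, GeomIrreducible P → 1 ≤ xdeg P → 1 ≤ deg_Y P → HeightComparisonAt P`, and `heightComparisonAt_of_siegelFunctions` PROVES `HeightComparisonAt P` from the GEOMETRIC datum `SiegelFunctions P ∧ SiegelFunctions (swap P)` (two integral functions of controlled degree for every b ≥ 1); the ARITHMETIC half (rational-root integrality, archimedean root bound, `h(y^b) = b·h(y)`, finite exceptional fibres by Bezout, exchange of variables) is proved sorry-free; hence `heightComparison_of_siegelFunctionsAll : SiegelFunctionsAll → HeightComparison` and the node-12 heads re-pointed BY NAME; the geometric half `SiegelFunctionsAll` is a typed HYPOTHESIS (plan S1–S6 in the docstring of `SiegelFunctions`), NOT proved;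 (G)-instances by hand: `parabP` / its transpose / `hyperbP`, and the infinite family 𝒞₃ = {(x·Y − 1)² − f(x) : f cubic, f(0) ≠ 1} in BOTH charts (Lucas trace; the 3 × 3 POWER LEMMA), its geometric irreducibility, and the HYPOTHESIS-FREE `heightComparisonAt_sqLinP` / `thinFibreAt_two_sqLinP` — ×0-AS-RECORD toolkit per RULING L3160 (every 𝒞₃ member is also decided by the numerator lever); `PadicSubspace`, items 33364 / 33363 / 31077 / 31987 and the tally UNMOVED — continuation (RootDecomp1KSiegelFunctions02): §2  Arithmetic of one monic relation: integrality (rational root theorem) and the archimedean root bound — 20 declarations `scaledEval` … `abs_le_of_rel`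

(lens-1 g71 NODE 31 «THE HEIGHT BINDER HALVED» L3172: HOME kernel K = HOME/decomp-schanuel-lens-1/g71/lean/SiegelFunctions.lean sha256 4f39c136…, 1983 l, 207 decls (173 theorems + 34 defs by the critic's count, VERDICT L3175; NODE's «208» an e-lite), ONE namespace `Summit.Schanuel.Schanuel.Theorems.RootDecomp1KSiegelFunctions` (inner anonymous-free sections `PowerLemma` / `Chart2` / `GeomIrreducible` with their `variable`s kept whole inside one part each), imports EXACTLY the tree port …RootDecomp1KHeightGrading02 (node 12: `HeightComparison`, `HeightDecidedAt`, `GeomIrreducible`, `logHt` BY TREE NAME) + `Literature.NumberTheory.DiophantineGeometry.PlaneCurveBezoutWeak` + `Mathlib.RingTheory.Polynomial.RationalRoot`; no private / instance / set_option / notation / sorry / new axiom / native_decide / [cite; lens farm rc 0 · 0 errors · 0 sorries · dupNamespace warnings only; `#print axioms` = [propext, Classical.choice, Quot.sound] on the nine probed heads (g71/out/ax_*.json), Probe g71/out/ProbeK.lean 2659bdec… rc 0 (rfl pin `HeightComparison` = tree), CONTROLS A / A0 / B rc 1 as designed (ctrlA 4ae3a6d6… / ctrlA0 ff875685… / ctrlB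 f20add70…), memo g71/NODE-g71.md 07fb49f8…, SHA256SUMS 34 files; CLAIM 31 L3146; crit PRICE 31 L3149 (×0-as-record + one contingent ×1 at FLOOR G; CHECKLIST K-g71; RULES K-R59 / K-R60 pre-announced); lens ASK-FIRST FAMILY CLAIM L3158 (𝒞₃) and crit RULING L3160 (𝒞₃ REFUSED as a FLOOR-G (b) family: numerator lever, NUMEXP; toolkit ×0 under K-R60 (i)); census INSTRUMENT NOTES 54–56 L3161 / L3163 / L3167 (LIVENESS-v46 / v47 / v48: rows 75–77 = 𝒞₃ members, keys numexp / numexp_tight / k60) and crit ACKs L3165 / L3168; writer NOTES 4 / 5 L3162 / L3173; crit-1 (g13) VERDICT 31 L3175: «NODE 31 = ×0-AS-RECORD BOOKED; CHECKLIST K-g71 (J1)–(J7) MET; the contingent THEOREM ×1 REGISTERED under K-R59 (ii), UNPAID (FLOOR G unmet); RULES K-R59 and K-R60 (i)–(iv) FIXED; PORT GO» — kernel re-verified by the critic (farm rc 0 · 0 errors · 0 sorries; 207 decls = 173 theorems + 34 defs; axioms standard re-probed on 27 heads), record: piece C227 «HeightComparison ⟸ SiegelFunctionsAll», the K-line binder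 HeightComparison henceforth CONSUMED through heightComparison_of_siegelFunctionsAll (Dom re-pointing BY NAME, antecedent count unchanged), 𝒞₃ / InC3 decided hypothesis-free by thinFibreAt_of_inC3 / thinFibreAt_two_sqLinP = the K-R60 (i) kernel shape (TOOLKIT, ×0, never payable), tally UNCHANGED lens-1 ×22 + THEOREM ×24, EXHIBITS ρ1 / ρ2 VACANT, 33364 / 33363 / 31077 / 31987 OPEN rung 0. Port by census-1 gen 26 as `RootDecomp1KSiegelFunctions01–09` (files ≤ 400 lines; chain 01 ← the three K imports, 0k ← 0(k−1); `--supports stmt-Schanuel-33364`, the item stays OPEN; ×0 record port — the geometric binder `SiegelFunctions` / `SiegelFunctionsAll` appears ONLY as an explicit hypothesis of the `…_of_siegelFunctions…` heads, never an axiom / instance / variable; no credit anywhere; the section-aligned 9-part split is lens-1's port plan (J7) re-built by the census pipeline): 01 = K-port l.1–216 (§0 / §1) — 25 decls `ratModel`, `QDvd`, `relPoly`, …, `evalEval_ratModel_relPoly`; 02 = K-port l.219–450 (§2) — 20 decls `scaledEval`, `l1`, `l1_nonneg`, …, `abs_le_of_rel`; 03 = K-port l.453–658 (§3 / §4) — 9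 decls `HtQ_pow`, `logHt_pow`, `HtQ_intDiv_le`, …, `upperComparisonAt_of_siegelFunctions`; 04 = K-port l.661–830 (§5) — 13 decls `coeff_coeff_swap`, `map_swap`, `natDegree_swap`, …, `heightComparison_of_siegelFunctions`; 05 = K-port l.833–1105 (§6 / §7) — 28 decls `thinFibreAt_of_heightComparisonAt`, `thinFibreAt_of_heightComparison'`, `thinFibreAt_of_siegelFunctions`, …, `siegelFunctions_toys`; 06 = K-port l.1107–1300 (§8) — 20 decls `sqLinP`, `sqLinP_eq`, `natDegree_sqLinP`, …, `thinFibreAt_sqLinP_of_swap`; 07 = K-port l.1302–1547 (§9) — 35 decls `compM`, `cubic`, `cubic_eq`, …, `natDegree_det3_compM_pow_le`; 08 = K-port l.1549–1856 (§10) — 40 decls `q₃`, `q₂`, `q₁`, …, `heightComparisonAt_sqLinP_of_geomIrreducible`; 09 = K-port l.1858–2074 (§11 / §12) — 17 decls `sqLinK`, `coeff_sqLinK`, `natDegree_sqLinK`, …, `thinFibreAt_of_inC3`. 91 one-line docstrings synthesised for undocumented helper declarations (statements quoted); ONE port-side modifier of record: `sum_Icc_half_pow` (§2, part 02) is `private`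 with a PORT NOTE after the `dedup.landed` bounce p850627 (≡ `Literature.Computability.Cryptography.HashDom.sum_Icc_half_pow`); everything else = K VERBATIM (statements, names, proofs, K's module docstring kept in part 01 below this provenance block).)
-/

noncomputable section

namespace Summit.Schanuel.Schanuel.Theorems.RootDecomp1KSiegelFunctions

open Polynomial
open scoped Nat
open Summit.Schanuel.Schanuel.Theorems.RootDecomp1KDegreeLadder (bev xdeg natDegree_coeff_le_xdeg ThinFibreAt ThinFibre
  thinFibreAt_of_natDegree_lt)
open Summit.Schanuel.Schanuel.Theorems.RootDecomp1KHeightGrading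

/-! ### §2  Arithmetic of one monic relation: integrality (rational root theorem) and the archimedean root bound -/

/-- the height-denominator-cleared value `s^e · χ(r/s)` as an INTEGER (for `deg χ ≤ e`). -/
def scaledEval (χ : ℤ[X]) (r s : ℤ) (e : ℕ) : ℤ :=
  ∑ j ∈ Finset.range (χ.natDegree + 1), χ.coeff j * r ^ j * s ^ (e - j)

/-- the `ℓ¹`-norm of the coefficients (a real constant depending on `χ` only). -/
def l1 (χ : ℤ[X]) : ℝ := ∑ j ∈ Finset.range (χ.natDegree + 1), |(χ.coeff j : ℝ)|

/-- `(χ : ℤ[X]) : 0 ≤ l1 χ`. -/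
theorem l1_nonneg (χ : ℤ[X]) : 0 ≤ l1 χ := Finset.sum_nonneg fun _ _ => abs_nonneg _

/-- `s^e · χ(r/s) = scaledEval χ r s e` in `ℚ` when `deg χ ≤ e` and `s ≠ 0`. -/
theorem cast_scaledEval {χ : ℤ[X]} {r s : ℤ} {e : ℕ} (hs : s ≠ 0) (he : χ.natDegree ≤ e) :
    (scaledEval χ r s e : ℚ) = (s : ℚ) ^ e * aeval ((r : ℚ) / s) χ := by
  unfold scaledEval
  rw [aeval_eq_sum_range, Finset.mul_sum]
  push_cast
  refine Finset.sum_congr rfl fun j hj => ?_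
  have hj' : j ≤ e := le_trans (by simpa [Nat.lt_succ_iff] using Finset.mem_range.mp hj) he
  have hs' : (s : ℚ) ≠ 0 := by exact_mod_cast hs
  rw [zsmul_eq_mul, div_pow, ← pow_sub_mul_pow (s : ℚ) hj']
  field_simp

/-- `|scaledEval χ r s e| ≤ ‖χ‖₁ · max(|r|,|s|)^e`. -/
theorem abs_scaledEval_le (χ : ℤ[X]) (r s : ℤ) {e : ℕ} (he : χ.natDegree ≤ e) :
    |(scaledEval χ r s e : ℝ)| ≤ l1 χ * (max |(r : ℝ)| |(s : ℝ)|) ^ e := by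
  unfold scaledEval l1
  push_cast
  rw [Finset.sum_mul]
  refine (Finset.abs_sum_le_sum_abs _ _).trans (Finset.sum_le_sum fun j hj => ?_)
  have hj' : j ≤ e := le_trans (by simpa [Nat.lt_succ_iff] using Finset.mem_range.mp hj) he
  have hM : (0 : ℝ) ≤ max |(r : ℝ)| |(s : ℝ)| := le_max_of_le_left (abs_nonneg _)
  rw [abs_mul, abs_mul, abs_pow, abs_pow]
  calc |(χ.coeff j : ℝ)| * |(r : ℝ)| ^ j * |(s : ℝ)| ^ (e - j)
      ≤ |(χ.coeff j : ℝ)| * (max |(r : ℝ)| |(s : ℝ)|) ^ j * (max |(r : ℝ)| |(s : ℝ)|) ^ (e - j) := by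
        gcongr
        · exact le_max_left _ _
        · exact le_max_right _ _
    _ = |(χ.coeff j : ℝ)| * (max |(r : ℝ)| |(s : ℝ)|) ^ e := by
        rw [mul_assoc, ← pow_add, Nat.add_sub_cancel' hj']

/-- `Σ_{i=1}^{m} (1/2)^i = 1 − (1/2)^m`. (PORT NOTE, census-1 g26: PRIVATE — the statement is identical to the tree's
`Literature.Computability.Cryptography.HashDom.sum_Icc_half_pow` (Literature/Computability/Cryptography/HashingDomination.lean
l.403, outside this file's import closure and foreign to its subject); the gate's `dedup.landed` lint forbids a public restatement
(bounce p850627 of the first filing of part 02); K's statement and proof are kept verbatim under `private` for the single use in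
`root_bound` below (precedents p848905 / p850098).) -/
private theorem sum_Icc_half_pow (m : ℕ) : ∑ i ∈ Finset.Icc 1 m, (1 / 2 : ℝ) ^ i = 1 - (1 / 2) ^ m := by
  induction m with
  | zero => simp
  | succ m ih =>
    rw [Finset.sum_Icc_succ_top (by omega), ih]
    ring

/-- **weighted Cauchy (Fujiwara) bound**: a real root `u` of a monic relation `u^m + Σ_{i=1}^{m} c_i u^{m-i} = 0`
with `|c_i| ≤ (L/2)^i` satisfies `|u| ≤ L`. -/
theorem root_bound {m : ℕ} {c : ℕ → ℝ} {u L : ℝ} (hL : 0 < L)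
    (hc : ∀ i ∈ Finset.Icc 1 m, |c i| ≤ (L / 2) ^ i)
    (hroot : u ^ m + ∑ i ∈ Finset.Icc 1 m, c i * u ^ (m - i) = 0) : |u| ≤ L := by
  by_contra h
  push Not at h
  have hu : 0 < |u| := hL.trans h
  have hum : 0 < |u| ^ m := pow_pos hu m
  have h1 : |u| ^ m ≤ |u| ^ m * (1 - (1 / 2) ^ m) := by
    have heq : u ^ m = -∑ i ∈ Finset.Icc 1 m, c i * u ^ (m - i) := by linarith
    calc |u| ^ m = |u ^ m| := (abs_pow u m).symm
      _ = |∑ i ∈ Finset.Icc 1 m, c i * u ^ (m - i)| := by rw [heq, abs_neg]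
      _ ≤ ∑ i ∈ Finset.Icc 1 m, |c i * u ^ (m - i)| := Finset.abs_sum_le_sum_abs _ _
      _ ≤ ∑ i ∈ Finset.Icc 1 m, (|u| / 2) ^ i * |u| ^ (m - i) := by
          refine Finset.sum_le_sum fun i hi => ?_
          rw [abs_mul, abs_pow]
          refine mul_le_mul_of_nonneg_right ((hc i hi).trans ?_) (pow_nonneg (abs_nonneg _) _)
          gcongr
      _ = |u| ^ m * ∑ i ∈ Finset.Icc 1 m, (1 / 2 : ℝ) ^ i := by
          rw [Finset.mul_sum]
          refine Finset.sum_congr rfl fun i hi => ?_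
          have him : i ≤ m := (Finset.mem_Icc.mp hi).2
          rw [div_pow, div_eq_mul_one_div, mul_right_comm, ← pow_add, Nat.add_sub_cancel' him, one_div_pow]
      _ = |u| ^ m * (1 - (1 / 2) ^ m) := by rw [sum_Icc_half_pow]
  have h2 : (0 : ℝ) < (1 / 2) ^ m := by positivity
  nlinarith

/-- the MONIC INTEGER polynomial `T^m + Σ_{i=1}^{m} D^{i-1}·s^{a i}χ_i(r/s)·T^{m-i}` whose root is `u = D·s^a·t`. -/
def monicRel (m : ℕ) (D : ℤ) (χ : ℕ → ℤ[X]) (r s : ℤ) (a : ℕ) : ℤ[X] :=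
  X ^ m + ∑ i ∈ Finset.Icc 1 m, C (D ^ (i - 1) * scaledEval (χ i) r s (a * i)) * X ^ (m - i)

/-- `{m : ℕ} (hm : 1 ≤ m) (D : ℤ) (χ : ℕ → ℤ[X]) (r s : ℤ) (a : ℕ) : (monicRel m D χ r s a).Monic`. -/
theorem monic_monicRel {m : ℕ} (hm : 1 ≤ m) (D : ℤ) (χ : ℕ → ℤ[X]) (r s : ℤ) (a : ℕ) :
    (monicRel m D χ r s a).Monic := by
  unfold monicRel
  refine (monic_X_pow m).add_of_left ?_
  rw [degree_X_pow]
  refine (degree_sum_le _ _).trans_lt ((Finset.sup_lt_iff (WithBot.bot_lt_coe m)).mpr ?_)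
  intro i hi
  have hi1 : 1 ≤ i := (Finset.mem_Icc.mp hi).1
  exact (degree_C_mul_X_pow_le _ _).trans_lt (WithBot.coe_lt_coe.mpr (Nat.sub_lt hm hi1))

/-- evaluation of `monicRel` in `ℚ`. -/
theorem aeval_monicRel (m : ℕ) (D : ℤ) (χ : ℕ → ℤ[X]) (r s : ℤ) (a : ℕ) (u : ℚ) :
    aeval u (monicRel m D χ r s a) =
      u ^ m + ∑ i ∈ Finset.Icc 1 m, (D : ℚ) ^ (i - 1) * (scaledEval (χ i) r s (a * i) : ℚ) * u ^ (m - i) := by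
  unfold monicRel
  rw [map_add, map_sum, aeval_X_pow]
  congr 1
  refine Finset.sum_congr rfl fun i _ => ?_
  rw [map_mul, aeval_X_pow, aeval_C, algebraMap_int_eq, eq_intCast]
  push_cast
  ring

/-- the scaled relation: `u = D·s^a·t` is a root of `monicRel` (over `ℚ`), given the relation for `t` at `x = r/s`. -/
theorem aeval_monicRel_eq_zero {m a : ℕ} (hm : 1 ≤ m) {D : ℤ} {χ : ℕ → ℤ[X]}
    (hχ : ∀ i, (χ i).natDegree ≤ a * i) {r s : ℤ} (hs : s ≠ 0) {t : ℚ}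
    (hrel : (D : ℚ) * t ^ m + ∑ i ∈ Finset.Icc 1 m, (aeval ((r : ℚ) / s) (χ i) : ℚ) * t ^ (m - i) = 0) :
    aeval ((D : ℚ) * (s : ℚ) ^ a * t) (monicRel m D χ r s a) = 0 := by
  set u : ℚ := (D : ℚ) * (s : ℚ) ^ a * t with hu
  have key : ∀ i ∈ Finset.Icc 1 m,
      (D : ℚ) ^ (i - 1) * (scaledEval (χ i) r s (a * i) : ℚ) * u ^ (m - i) =
        (D : ℚ) ^ (m - 1) * (s : ℚ) ^ (a * m) * ((aeval ((r : ℚ) / s) (χ i) : ℚ) * t ^ (m - i)) := by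
    intro i hi
    obtain ⟨hi1, him⟩ := Finset.mem_Icc.mp hi
    have e1 : (D : ℚ) ^ (i - 1) * (D : ℚ) ^ (m - i) = (D : ℚ) ^ (m - 1) := by
      rw [← pow_add]; congr 1; omega
    have e2 : (s : ℚ) ^ (a * i) * ((s : ℚ) ^ a) ^ (m - i) = (s : ℚ) ^ (a * m) := by
      rw [← pow_mul, ← pow_add, ← mul_add, Nat.add_sub_cancel' him]
    rw [cast_scaledEval hs (hχ i), hu]
    calc (D : ℚ) ^ (i - 1) * ((s : ℚ) ^ (a * i) * (aeval ((r : ℚ) / s) (χ i) : ℚ)) *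
          ((D : ℚ) * (s : ℚ) ^ a * t) ^ (m - i)
        = ((D : ℚ) ^ (i - 1) * (D : ℚ) ^ (m - i)) * ((s : ℚ) ^ (a * i) * ((s : ℚ) ^ a) ^ (m - i)) *
            ((aeval ((r : ℚ) / s) (χ i) : ℚ) * t ^ (m - i)) := by ring
      _ = _ := by rw [e1, e2]
  have e0 : u ^ m = (D : ℚ) ^ (m - 1) * (s : ℚ) ^ (a * m) * ((D : ℚ) * t ^ m) := by
    have hD : (D : ℚ) ^ m = (D : ℚ) ^ (m - 1) * D := by
      rw [← pow_succ, Nat.sub_add_cancel hm]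
    rw [hu, mul_pow, mul_pow, ← pow_mul, hD]; ring
  rw [aeval_monicRel, Finset.sum_congr rfl key, ← Finset.mul_sum, e0, ← mul_add, hrel, mul_zero]

/-- **integrality** (rational root theorem, Mathlib `isInteger_of_is_root_of_monic`): `D·den(x)^a·t ∈ ℤ`. -/
theorem exists_int_eq_of_rel {m a : ℕ} (hm : 1 ≤ m) {D : ℤ} {χ : ℕ → ℤ[X]}
    (hχ : ∀ i, (χ i).natDegree ≤ a * i) {x t : ℚ}
    (hrel : (D : ℚ) * t ^ m + ∑ i ∈ Finset.Icc 1 m, (aeval x (χ i) : ℚ) * t ^ (m - i) = 0) :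
    ∃ u : ℤ, (u : ℚ) = (D : ℚ) * (x.den : ℚ) ^ a * t := by
  have hs : (x.den : ℤ) ≠ 0 := by exact_mod_cast x.den_ne_zero
  have hx : ((x.num : ℚ) / ((x.den : ℤ) : ℚ)) = x := by push_cast; exact Rat.num_div_den x
  have hrel' := hrel
  rw [← hx] at hrel'
  have h := isInteger_of_is_root_of_monic (monic_monicRel hm D χ x.num (x.den : ℤ) a)
    (aeval_monicRel_eq_zero hm hχ hs hrel')
  obtain ⟨u, hu⟩ := h
  refine ⟨u, ?_⟩
  have : (algebraMap ℤ ℚ) u = (u : ℚ) := by simp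
  rw [← this, hu]; push_cast; ring

/-- the height base `H(q) = max(|num q|, den q) ≥ 1` (so `logHt q = log H(q)`, tree `logHt`). -/
def HtQ (q : ℚ) : ℝ := max |(q.num : ℝ)| (q.den : ℝ)

/-- `(q : ℚ) : logHt q = Real.log (HtQ q)`. -/
theorem logHt_eq_log_HtQ (q : ℚ) : logHt q = Real.log (HtQ q) := rfl

/-- `(q : ℚ) : 1 ≤ HtQ q`. -/
theorem one_le_HtQ (q : ℚ) : 1 ≤ HtQ q := one_le_htMax q

/-- `(q : ℚ) : 0 < HtQ q`. -/
theorem HtQ_pos (q : ℚ) : 0 < HtQ q := htMax_pos q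

/-- the constant of the archimedean root bound (depends on the relation only, not on the point). -/
def relConst (m : ℕ) (D : ℤ) (χ : ℕ → ℤ[X]) : ℝ :=
  2 * max 1 |(D : ℝ)| * (1 + ∑ i ∈ Finset.Icc 1 m, l1 (χ i))

/-- `(m : ℕ) (D : ℤ) (χ : ℕ → ℤ[X]) : 2 ≤ relConst m D χ`. -/
theorem two_le_relConst (m : ℕ) (D : ℤ) (χ : ℕ → ℤ[X]) : 2 ≤ relConst m D χ := by
  unfold relConst
  have h1 : (1 : ℝ) ≤ max 1 |(D : ℝ)| := le_max_left _ _
  have h2 : (1 : ℝ) ≤ 1 + ∑ i ∈ Finset.Icc 1 m, l1 (χ i) :=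
    le_add_of_nonneg_right (Finset.sum_nonneg fun i _ => l1_nonneg _)
  nlinarith

/-- `(m : ℕ) (D : ℤ) (χ : ℕ → ℤ[X]) : 0 < relConst m D χ`. -/
theorem relConst_pos (m : ℕ) (D : ℤ) (χ : ℕ → ℤ[X]) : 0 < relConst m D χ :=
  lt_of_lt_of_le two_pos (two_le_relConst m D χ)

/-- **archimedean bound** (weighted Cauchy bound on the scaled monic relation): `|D·den(x)^a·t| ≤ K·H(x)^a`
with `K = relConst` INDEPENDENT of the point — the exponent is `a`, NOT `a·m`: this homogeneity is what makes the
height transfer sharp. -/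
theorem abs_le_of_rel {m a : ℕ} (hm : 1 ≤ m) {D : ℤ} {χ : ℕ → ℤ[X]}
    (hχ : ∀ i, (χ i).natDegree ≤ a * i) {x t : ℚ}
    (hrel : (D : ℚ) * t ^ m + ∑ i ∈ Finset.Icc 1 m, (aeval x (χ i) : ℚ) * t ^ (m - i) = 0) :
    |(((D : ℚ) * (x.den : ℚ) ^ a * t : ℚ) : ℝ)| ≤ relConst m D χ * HtQ x ^ a := by
  have hs : (x.den : ℤ) ≠ 0 := by exact_mod_cast x.den_ne_zero
  have hx : ((x.num : ℚ) / ((x.den : ℤ) : ℚ)) = x := by push_cast; exact Rat.num_div_den x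
  have hrel' := hrel
  rw [← hx] at hrel'
  have hq := aeval_monicRel_eq_zero hm hχ hs hrel'
  rw [aeval_monicRel] at hq
  set u : ℝ := (((D : ℚ) * (x.den : ℚ) ^ a * t : ℚ) : ℝ) with hu
  have hR : u ^ m + ∑ i ∈ Finset.Icc 1 m,
      ((D : ℝ) ^ (i - 1) * (scaledEval (χ i) x.num (x.den : ℤ) (a * i) : ℝ)) * u ^ (m - i) = 0 := by
    have h := congrArg (fun q : ℚ => (q : ℝ)) hq
    simp only [Rat.cast_add, Rat.cast_sum, Rat.cast_mul, Rat.cast_pow, Rat.cast_intCast, Rat.cast_zero] at h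
    rw [hu]
    push_cast
    exact h
  have hH1 : 1 ≤ HtQ x := one_le_HtQ x
  have hHa : 0 < HtQ x ^ a := pow_pos (HtQ_pos x) a
  set B : ℝ := 1 + ∑ i ∈ Finset.Icc 1 m, l1 (χ i) with hB
  have hB1 : 1 ≤ B := le_add_of_nonneg_right (Finset.sum_nonneg fun i _ => l1_nonneg _)
  have hM1 : (1 : ℝ) ≤ max 1 |(D : ℝ)| := le_max_left _ _
  refine root_bound (mul_pos (relConst_pos m D χ) hHa) (fun i hi => ?_) hR
  obtain ⟨hi1, him⟩ := Finset.mem_Icc.mp hi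
  have hL2 : relConst m D χ * HtQ x ^ a / 2 = max 1 |(D : ℝ)| * B * HtQ x ^ a := by
    rw [hB]; unfold relConst; ring
  rw [hL2]
  have hmax : max |((x.num : ℤ) : ℝ)| |(((x.den : ℤ) : ℤ) : ℝ)| = HtQ x := by
    unfold HtQ; push_cast; rw [Nat.abs_cast]
  have hse := abs_scaledEval_le (χ i) x.num (x.den : ℤ) (hχ i)
  rw [hmax] at hse
  have hD : |(D : ℝ)| ^ (i - 1) ≤ (max 1 |(D : ℝ)|) ^ i :=
    (pow_le_pow_left₀ (abs_nonneg _) (le_max_right _ _) _).trans (pow_le_pow_right₀ hM1 (Nat.sub_le i 1))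
  have hl1 : l1 (χ i) ≤ B ^ i := by
    refine le_trans ?_ (le_self_pow₀ hB1 (by omega))
    have hsing : l1 (χ i) ≤ ∑ j ∈ Finset.Icc 1 m, l1 (χ j) :=
      Finset.single_le_sum (f := fun j => l1 (χ j)) (fun j _ => l1_nonneg _) hi
    rw [hB]
    linarith
  rw [abs_mul, abs_pow]
  calc |(D : ℝ)| ^ (i - 1) * |(scaledEval (χ i) x.num (x.den : ℤ) (a * i) : ℝ)|
      ≤ (max 1 |(D : ℝ)|) ^ i * (B ^ i * (HtQ x ^ a) ^ i) := by
        rw [← pow_mul]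
        exact mul_le_mul hD (hse.trans (mul_le_mul_of_nonneg_right hl1 (by positivity))) (abs_nonneg _)
          (by positivity)
    _ = (max 1 |(D : ℝ)| * B * HtQ x ^ a) ^ i := by ring

end Summit.Schanuel.Schanuel.Theorems.RootDecomp1KSiegelFunctions
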